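import Summits.QuantumFields.GaugeBoot.PlanarBootstrapLargeN
import Summits.QuantumFields.GaugeBoot.WordLoopZdLimit
import Summits.QuantumFields.GaugeBoot.BootstrapChargeConjugation
import Literature.MathematicalPhysics.QuantumFieldTheory.ShenZhuZhuLargeNFactorization
import HarnessLib

/-!
# At strong 't Hooft coupling, planar certificates are asymptotic bounds for `SU(N)` lattice Yang–Mills as `N → ∞` — modulo Shen–Zhu–Zhu's variance bound (gauge-boot, large-`N` supplement 6)

HONEST FRAMING (cell `pub-gaugeboot`, page 1 of every file): the venture produces certified bounds
on lattice expectations at stated coupling, gauge group, dimension and torus size; NOT a mass gap,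
NOT a continuum limit, NOT a string tension; NOT large `N` unless marked CONDITIONAL; NOT
Yang–Mills-summit-bearing (barriers `FixedCouplingUltralocality`, `PerturbativeInvisibility`).
CONDITIONAL on the tree's named fact `shenZhuZhu_largeN_variance` (Shen–Zhu–Zhu, CMP 400 (2023)
Cor. 1.5 (1.12), a PUBLISHED theorem typed as a hypothesis, not proved in the tree); it certifies no
number and no planar certificate of the cell exists in the tree.

## Content

Supplement 5 (`PlanarBootstrapLargeN`) reduced "planar certificate ⇒ asymptotic bound as `N → ∞`"
to the concentration of the imaginary parts of the certificate's loop variables,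
`E_{μ_N}[(Im tr hol(C)/N)²] → 0`.  This file discharges that condition for the thermodynamic limit
points of the `SU(N)` torus Wilson states at strong 't Hooft coupling from Shen–Zhu–Zhu:

* ★ `integral_im_trace_wordHolonomyZd_eq_zero_of_isInfiniteVolumeLimitAlong` /
  `integral_im_loopTrZd_eq_zero_of_mem_infiniteVolumeLimitPoints` — **Wilson loops are real at every
  torus limit point**: `E_μ[Im tr hol(C)] = 0` (charge conjugation on every torus,
  `BootstrapChargeConjugation.wilson_loopIm_eq_zero_suN`, passed to the limit along bounded
  continuous cylinder observables);
* `loopImCov_self_eq_variance` — hence `Γ_μ(C, C) = Var_μ(Im t_C)`;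
* ★★ `tendsto_loopImCov_zero_of_szz` — for `d ≥ 2`, `|βt| < 1/(16(d−1))`, limit points `μ_N` at tree
  coupling `N·βt`, and a word `C` realised by a non-backtracking closed walk `γ` (`hol_γ = hol_C` on
  every configuration): `Γ_{μ_N}(C, C) ≤ Var(Re) + Var(Im) ≤ 4 n(n−3)/(K_𝒮 N) → 0` GIVEN SZZ (1.12);
* ★★★ `PlanarCertificate.eventually_obj_le_suN_strongCoupling` — **GIVEN SZZ (1.12): for `d ≥ 2`
  and `|βt| < 1/(16(d−1))`, every valid planar certificate (`obj ≤ bound`) whose relaxation loops and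
  marked words are realised by non-backtracking closed walks, and whose identification rows hold
  for the states, satisfies: for every `δ > 0`, `obj(W_{μ_N}) ≤ bound + δ` for all large `N`, for ANY
  choice of thermodynamic limit points `μ_N` of the `SU(N)` torus Wilson states at tree coupling
  `N·βt`**; `…le_bound_of_tendsto_strongCoupling`: limits of the finite-`N` values obey the bound.

So in the strong-coupling window the planar numbers of a Kazakov–Zheng certificate ARE statements
about `SU(N)` at large `N` — with "large" not quantified (no rate is claimed: SZZ's `O(1/N²)`
variance would give one, not typed here), and nothing at `|βt| ≥ 1/(16(d−1))` (there the
concentration is the open CONDITION of supplement 5).  References: Shen–Zhu–Zhu CMP 400 (2023)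
Cor. 1.5; Kazakov–Zheng arXiv:2203.11360; 't Hooft 1974 (planar limit). [folklore] otherwise.
-/

noncomputable section

open MeasureTheory ProbabilityTheory Filter Topology
open scoped BigOperators
open Literature.Probability.LatticeModels (Site zdGraph)
open Literature.MathematicalPhysics.QuantumLattice
open Literature.MathematicalPhysics.QuantumFieldTheory (wilsonExpectation szzThresholdSU szzBakryEmeryConstSU
  szzBakryEmeryConstSU_eq shenZhuZhu_largeN_variance IsNonBacktrackingLoop wilsonLoopTrace wilsonLoopTrace_apply)

namespace Summit.QuantumFields.GaugeBoot

variable {d N : ℕ}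

/-! ## Wilson loops are real at torus limit points -/

/-- ★ **`E_μ[Im tr hol_x(C)] = 0` at every infinite-volume limit of the `SU(N)` torus Wilson
states** (charge conjugation `U ↦ Ū` on every torus, transported along the bounded continuous
cylinder observable `Im tr hol_x(C)`). [folklore] -/
theorem integral_im_trace_wordHolonomyZd_eq_zero_of_isInfiniteVolumeLimitAlong {β : ℝ} {Lk : ℕ → ℕ}
    {μ : Measure (LGConfig d (Matrix.specialUnitaryGroup (Fin N) ℂ))}
    (hμ : IsInfiniteVolumeLimitAlong (fundamentalRep (Fin N)) β Lk μ) (x : Site d) (C : Word d) :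
    ∫ U, ((fundamentalRep (Fin N)) (wordHolonomyZd U x C)).trace.im ∂μ = 0 := by
  set F : LGConfig d (Matrix.specialUnitaryGroup (Fin N) ℂ) → ℝ :=
    fun U => ((fundamentalRep (Fin N)) (wordHolonomyZd U x C)).trace.im with hF
  obtain ⟨S, hS⟩ := exists_dependsOn_wordHolonomyZd (G := Matrix.specialUnitaryGroup (Fin N) ℂ) x C
  have hcyl : IsCylinder F S := fun U V hUV => by simp only [hF, hS U V hUV]
  have hcont : Continuous F :=
    Complex.continuous_im.comp (((continuous_fundamentalRep (Fin N)).comp (continuous_wordHolonomyZd x C)).matrix_trace)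
  have hbd : ∃ C0 : ℝ, ∀ U, |F U| ≤ C0 :=
    ⟨N, fun U => (Complex.abs_im_le_norm _).trans (norm_trace_rep_le _ (continuous_fundamentalRep (Fin N)) _)⟩
  have h := hμ.2 F S hcyl hcont hbd
  have h0 : ∀ k, wilsonExpectation (L := Lk k + 1) (fundamentalRep (Fin N)) β (toTorusObservable (Lk k + 1) F) = 0 := by
    intro k
    have hw := wilson_loopIm_eq_zero_suN (d := d) (L := Lk k + 1) N β
      (Literature.Probability.LatticeModels.Torus.proj (Lk k + 1) x) C
    have he : ∀ U, toTorusObservable (Lk k + 1) F U =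
        loopIm (fundamentalLatticeRep N) (Literature.Probability.LatticeModels.Torus.proj (Lk k + 1) x) C U := fun U => by
      rw [toTorusObservable_apply, loopIm_apply, fundamentalLatticeRep_ρ, hF]
      simp only [wordHolonomyZd_torusLift]
      rfl
    unfold wilsonExpectation
    simp_rw [he]
    exact hw
  simp only [h0] at h
  exact (tendsto_const_nhds_iff.1 h).symm

/-- ★ **`E_μ[Im t_C] = 0` for every thermodynamic limit point** of the `SU(N)` torus Wilson states,
every word `C`, every real `β`. [folklore] -/
theorem integral_im_loopTrZd_eq_zero_of_mem_infiniteVolumeLimitPoints {β : ℝ}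
    {μ : Measure (LGConfig d (Matrix.specialUnitaryGroup (Fin N) ℂ))}
    (hμ : μ ∈ infiniteVolumeLimitPoints (d := d) (fundamentalRep (Fin N)) β) (x : Site d) (C : Word d) :
    ∫ U, (loopTrZd (fundamentalRep (Fin N)) x C U).im ∂μ = 0 := by
  obtain ⟨Lk, -, hL⟩ := hμ
  have h := integral_im_trace_wordHolonomyZd_eq_zero_of_isInfiniteVolumeLimitAlong hL x C
  simp only [loopTrZd_apply, Complex.div_natCast_im]
  rw [integral_div, h, zero_div]

/-! ## `Γ(C, C)` is the variance of `Im t_C` when its mean vanishes -/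

/-- For a probability measure with `E[Im t_C] = 0`: `Γ(C, C) = Var(Im t_C)`. [folklore] -/
theorem loopImCov_self_eq_variance {G : Type*} [Group G] [TopologicalSpace G] [IsTopologicalGroup G] [CompactSpace G]
    [MeasurableSpace G] [BorelSpace G] (ρ : G →* Matrix (Fin N) (Fin N) ℂ) (hρ : Continuous ρ)
    (μ : Measure (LGConfig d G)) [IsProbabilityMeasure μ] (x : Site d) (C : Word d)
    (h0 : ∫ U, (loopTrZd ρ x C U).im ∂μ = 0) :
    loopImCov ρ μ x C C = Var[fun U => (loopTrZd ρ x C U).im; μ] := by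
  have hm : AEMeasurable (fun U => (loopTrZd ρ x C U).im) μ :=
    (Complex.continuous_im.comp_aestronglyMeasurable (aestronglyMeasurable_loopTrZd ρ hρ μ x C)).aemeasurable
  rw [loopImCov_self_eq, variance_eq_integral hm]
  refine integral_congr_ae (Eventually.of_forall fun U => ?_)
  show (loopTrZd ρ x C U).im ^ 2 = ((loopTrZd ρ x C U).im - ∫ U, (loopTrZd ρ x C U).im ∂μ) ^ 2
  rw [h0, sub_zero]

/-! ## The concentration from Shen–Zhu–Zhu at strong 't Hooft coupling -/

/-- `(4/K_𝒮(N)) · a/N → 0` for `|βt| < 1/(16(d−1))`, `d ≥ 2` (`K_𝒮 = N(1/2 − 8|βt|(d−1))`).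
[cite: ShenZhuZhuCMP2023, (1.12)] -/
theorem tendsto_szz_const_div (hd : 2 ≤ d) {βt : ℝ} (hβ : |βt| < szzThresholdSU d) (a : ℝ) :
    Tendsto (fun N : ℕ => 4 / szzBakryEmeryConstSU N d βt * (a / N)) atTop (𝓝 0) := by
  have hd' : (0 : ℝ) < (d : ℝ) - 1 := by
    have : (2 : ℝ) ≤ d := by exact_mod_cast hd
    linarith
  have hc : 0 < 1 / 2 - 8 * |βt| * ((d : ℝ) - 1) := by
    rw [szzThresholdSU, lt_div_iff₀ (by positivity)] at hβ
    nlinarith [abs_nonneg βt]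
  have hK : ∀ N : ℕ, szzBakryEmeryConstSU N d βt = N * (1 / 2 - 8 * |βt| * ((d : ℝ) - 1)) :=
    fun N => by rw [szzBakryEmeryConstSU_eq]; ring
  have h1 : Tendsto (fun N : ℕ => 4 * a / (1 / 2 - 8 * |βt| * ((d : ℝ) - 1)) / (N : ℝ) / (N : ℝ))
      atTop (𝓝 0) :=
    (tendsto_const_div_atTop_nhds_zero_nat _).div_atTop tendsto_natCast_atTop_atTop
  refine h1.congr' ?_
  filter_upwards [eventually_gt_atTop 0] with N hN
  have hN' : (0 : ℝ) < N := by exact_mod_cast hN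
  rw [hK]
  field_simp

/-- ★★ **Concentration of the imaginary parts at strong coupling, from SZZ (1.12)**: `d ≥ 2`,
`|βt| < 1/(16(d−1))`, `μ_N` thermodynamic limit points of the `SU(N)` torus Wilson states at tree
coupling `N·βt`, and a word `C` based at `x` realised by a non-backtracking closed walk `γ`
(`hol_γ(U) = hol_x(C)(U)` for all configurations, all `N`): then `E_{μ_N}[(Im t_C)²] → 0`
(`= Var(Im W_γ/N) ≤ 4 n(n−3)/(K_𝒮 N)`, `K_𝒮 ∝ N`). Conditional on `shenZhuZhu_largeN_variance`.
[cite: ShenZhuZhuCMP2023, Corollary 1.5] -/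
theorem tendsto_loopImCov_zero_of_szz (hfact : ∀ N, shenZhuZhu_largeN_variance d N) (hd : 2 ≤ d)
    {βt : ℝ} (hβ : |βt| < szzThresholdSU d)
    (μ : (N : ℕ) → Measure (LGConfig d (Matrix.specialUnitaryGroup (Fin N) ℂ)))
    (hμ : ∀ N, 1 ≤ N → μ N ∈ infiniteVolumeLimitPoints (d := d) (fundamentalRep (Fin N)) ((N : ℝ) * βt))
    (x : Site d) (C : Word d) (γ : (zdGraph d).Walk x x) (hγ : IsNonBacktrackingLoop γ)
    (hhol : ∀ (N : ℕ) (U : LGConfig d (Matrix.specialUnitaryGroup (Fin N) ℂ)), walkHolonomy U γ = wordHolonomyZd U x C) :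
    Tendsto (fun N => loopImCov (fundamentalRep (Fin N)) (μ N) x C C) atTop (𝓝 0) := by
  have hb := tendsto_szz_const_div hd hβ ((γ.length : ℝ) * ((γ.length : ℝ) - 3))
  refine tendsto_of_tendsto_of_tendsto_of_le_of_le' tendsto_const_nhds hb
    (Eventually.of_forall fun N => loopImCov_self_nonneg _ (μ N) x C) ?_
  filter_upwards [eventually_ge_atTop 1] with N hN
  have hlim := hμ N hN
  haveI : IsProbabilityMeasure (μ N) := by obtain ⟨L, -, hL⟩ := hlim; exact hL.1
  have hvar := (hfact N).1 hd hN βt hβ (μ N) hlim x γ hγ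
  -- `Γ(C,C) = Var(Im t_C) = Var(Im W_γ / N) ≤ Var(Re) + Var(Im)`
  have h0 := integral_im_loopTrZd_eq_zero_of_mem_infiniteVolumeLimitPoints hlim x C
  rw [loopImCov_self_eq_variance _ (continuous_fundamentalRep (Fin N)) (μ N) x C h0]
  have hfun : (fun U : LGConfig d (Matrix.specialUnitaryGroup (Fin N) ℂ) => (loopTrZd (fundamentalRep (Fin N)) x C U).im) =
      fun U => (wilsonLoopTrace (fundamentalRep (Fin N)) γ U).im / N := by
    funext U
    rw [loopTrZd_apply, Complex.div_natCast_im, wilsonLoopTrace_apply, hhol N U]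
  rw [hfun]
  exact le_trans (le_add_of_nonneg_left (variance_nonneg _ _)) hvar

/-! ## The strong-coupling large-`N` theorem -/

namespace PlanarCertificate

variable (P : PlanarCertificate d)

/-- ★★★ **PLANAR CERTIFICATES BOUND `SU(N)` LATTICE YANG–MILLS ASYMPTOTICALLY AT STRONG 'T HOOFT
COUPLING (given SZZ (1.12)).**  Let `d ≥ 2`, `|βt| < 1/(16(d−1))`, `P` a valid planar certificate at
`βt` whose relaxation loops `ℓ_A` and marked words `w_r` are realised by non-backtracking closed walks
at `x` (all rows and Gram words closed at `x`), and for each `N ≥ 1` let `μ_N` be ANY thermodynamic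
limit point of the `SU(N)` torus Wilson states at tree coupling `N·βt` satisfying the certificate's
identification rows.  Then, assuming `shenZhuZhu_largeN_variance` for all `N`:
for every `δ > 0`, `obj(W_{μ_N}) ≤ bound + δ` for all sufficiently large `N`.
[cite: ShenZhuZhuCMP2023, Corollary 1.5] -/
theorem eventually_obj_le_suN_strongCoupling (hP : P.IsValid) (hfact : ∀ N, shenZhuZhu_largeN_variance d N)
    (hd : 2 ≤ d) (hβ : |P.βt| < szzThresholdSU d)
    (μ : (N : ℕ) → Measure (LGConfig d (Matrix.specialUnitaryGroup (Fin N) ℂ)))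
    (hμ : ∀ N, 1 ≤ N → μ N ∈ infiniteVolumeLimitPoints (d := d) (fundamentalRep (Fin N)) ((N : ℝ) * P.βt))
    (x : Site d) (hrow : ∀ r, Word.endpointZd x (P.rowWord r) = x) (hgram : ∀ j i, Word.endpointZd x (P.gramWord j i) = x)
    (hlin : ∀ N, 1 ≤ N → ∀ e, P.lin e (loopW (fundamentalRep (Fin N)) (μ N) x) (loopQ (fundamentalRep (Fin N)) (μ N) x) = 0)
    (γS : (A : Fin P.nI) → (zdGraph d).Walk x x) (hγS : ∀ A, IsNonBacktrackingLoop (γS A))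
    (hholS : ∀ A (N : ℕ) (U : LGConfig d (Matrix.specialUnitaryGroup (Fin N) ℂ)), walkHolonomy U (γS A) = wordHolonomyZd U x (P.shorLoop A))
    (γR : (r : Fin P.nR) → (zdGraph d).Walk x x) (hγR : ∀ r, IsNonBacktrackingLoop (γR r))
    (hholR : ∀ r (N : ℕ) (U : LGConfig d (Matrix.specialUnitaryGroup (Fin N) ℂ)), walkHolonomy U (γR r) = wordHolonomyZd U x (P.rowWord r)) :
    ∀ δ > 0, ∀ᶠ N in atTop, P.obj (loopW (fundamentalRep (Fin N)) (μ N) x) ≤ P.bound + δ := by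
  have hprob : ∀ N, 1 ≤ N → IsProbabilityMeasure (μ N) := fun N hN => by
    obtain ⟨L, -, hL⟩ := hμ N hN; exact hL.1
  have hhs : ∀ N, 1 ≤ N → IsHaarShiftState (fundamentalRep (Fin N)) ((N : ℝ) * P.βt) (μ N) := fun N hN => by
    haveI : SecondCountableTopology (Matrix (Fin N) (Fin N) ℂ) :=
      inferInstanceAs (SecondCountableTopology (Fin N → Fin N → ℂ))
    haveI : SecondCountableTopology (Matrix.specialUnitaryGroup (Fin N) ℂ) :=
      Topology.IsEmbedding.subtypeVal.secondCountableTopology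
    exact isHaarShiftState_of_mem_infiniteVolumeLimitPoints (fundamentalRep (Fin N)) (continuous_fundamentalRep (Fin N))
      (hμ N hN)
  exact P.eventually_obj_le_suN hP μ hprob hhs x hrow hgram hlin
    (fun A => tendsto_loopImCov_zero_of_szz hfact hd hβ μ hμ x _ (γS A) (hγS A) (hholS A))
    (fun r => tendsto_loopImCov_zero_of_szz hfact hd hβ μ hμ x _ (γR r) (hγR r) (hholR r))

/-- ★★ **Hence every limit of the finite-`N` values obeys the planar bound** at strong 't Hooft
coupling (given SZZ (1.12)): under the hypotheses of `eventually_obj_le_suN_strongCoupling`, if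
`obj(W_{μ_N}) → L` then `L ≤ bound`. [cite: ShenZhuZhuCMP2023, Corollary 1.5] -/
theorem le_bound_of_tendsto_strongCoupling (hP : P.IsValid) (hfact : ∀ N, shenZhuZhu_largeN_variance d N)
    (hd : 2 ≤ d) (hβ : |P.βt| < szzThresholdSU d)
    (μ : (N : ℕ) → Measure (LGConfig d (Matrix.specialUnitaryGroup (Fin N) ℂ)))
    (hμ : ∀ N, 1 ≤ N → μ N ∈ infiniteVolumeLimitPoints (d := d) (fundamentalRep (Fin N)) ((N : ℝ) * P.βt))
    (x : Site d) (hrow : ∀ r, Word.endpointZd x (P.rowWord r) = x) (hgram : ∀ j i, Word.endpointZd x (P.gramWord j i) = x)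
    (hlin : ∀ N, 1 ≤ N → ∀ e, P.lin e (loopW (fundamentalRep (Fin N)) (μ N) x) (loopQ (fundamentalRep (Fin N)) (μ N) x) = 0)
    (γS : (A : Fin P.nI) → (zdGraph d).Walk x x) (hγS : ∀ A, IsNonBacktrackingLoop (γS A))
    (hholS : ∀ A (N : ℕ) (U : LGConfig d (Matrix.specialUnitaryGroup (Fin N) ℂ)), walkHolonomy U (γS A) = wordHolonomyZd U x (P.shorLoop A))
    (γR : (r : Fin P.nR) → (zdGraph d).Walk x x) (hγR : ∀ r, IsNonBacktrackingLoop (γR r))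
    (hholR : ∀ r (N : ℕ) (U : LGConfig d (Matrix.specialUnitaryGroup (Fin N) ℂ)), walkHolonomy U (γR r) = wordHolonomyZd U x (P.rowWord r))
    {L : ℝ} (hL : Tendsto (fun N => P.obj (loopW (fundamentalRep (Fin N)) (μ N) x)) atTop (𝓝 L)) :
    L ≤ P.bound := by
  refine le_of_forall_pos_le_add fun δ hδ => ?_
  exact le_of_tendsto hL (P.eventually_obj_le_suN_strongCoupling hP hfact hd hβ μ hμ x hrow hgram hlin γS hγS hholS
    γR hγR hholR δ hδ)

end PlanarCertificate

end Summit.QuantumFields.GaugeBoot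

end
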